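import Literature.Algebra.EuclideanDomain.EuclideanOrderTypeEqLength
import Literature.Order.Ordinal.NaturalSumUpperBound
import Literature.Order.Ordinal.NaturalSumOmegaMultiples
import HarnessLib

/-!
# The Product Theorem for `n` factors, `e(R₁) + … + e(R_n) ≤ e(∏ Rᵢ) ≤ e(R₁) ⊕ … ⊕ e(R_n)`, and Samuel's bound
# `e(R₁ × R₂) ≤ e(R₁) e(R₂) + e(R₂) e(R₁)` (Clark 2015, Thm. 22 and Remark 2.7)

Topic `Literature/Algebra/EuclideanDomain`, namespace `Literature.Algebra.EuclideanDomain`.  THEOREMS ONLY (no `def`, no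
instance, no named fact), all proved, in the vocabulary of `TransfiniteSmallestAlgorithm.lean` (`samuelSet R α = A_α`,
`samuelRank = θ`; «`R` is Euclidean» for ordinal-valued functions ⟺ the transfinite construction exhausts `R`,
`∀ x, ∃ α, x ∈ samuelSet R α`), `EuclideanOrderTypeIndecomposable.lean` (the Euclidean order type
`e(R) = ⨆ z, ((θ z − 1) + 1)`) and `Literature/Order/Ordinal/NaturalSum.lean` (the natural sum `nadd α β = α ⊕ β`).
This resolves the `TODO(general form)` of `EuclideanOrderTypeProductUpperBound.lean` («`n` factors (induction on Clark's
(7)) and Samuel's weaker bound `e(R₁) e(R₂) + e(R₂) e(R₁)` are not spelled out»), which proves the case `n = 2`.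

## Source (read at the page)

P. L. Clark, *A note on Euclidean order types*, Order **32** (2015) 157–178 [Clark2015EuclideanOrderTypes] (materialised
`paper:arxiv-1208.0977`, p0006), §2.8, VERBATIM: «**Theorem 22.** (Product Theorem) Let `R₁, …, R_n` be Euclidean rings.
a) The ring `∏ᵢ₌₁ⁿ Rᵢ` is Euclidean iff `Rᵢ` is Euclidean for all `i`.  b) If the equivalent conditions of part a) hold, then
(7) `e(R₁) + … + e(R_n) ≤ e(∏ᵢ₌₁ⁿ Rᵢ) ≤ e(R₁) ⊕ … ⊕ e(R_n)`.  Proof. Induction reduces us to the case `n = 2`. …»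
«**Remark 2.7:** The upper bound on the order type of the product ring in (7) is essentially due to Nagata. Moreover, in the
proof of Proposition 6 of [Samuel71], Samuel gives the bound `e(R₁ × R₂) ≤ e(R₁) × e(R₂) + e(R₂) × e(R₁)`. By Proposition 4 b),
Samuel's bound is not as good as Nagata's: there is a penalty to pay for employing the “usual” ordinal operations rather than
the Hessenberg-Brookfield sum.»  (Prop. 4 (b): «`max(α + β, β + α) ≤ α ⊕ β ≤ αβ + βα`», in the tree as
`nadd_le_mul_add_mul` for `α, β > 0`, `NaturalSumUpperBound.lean`.)  P. Samuel, *About Euclidean rings*, J. Algebra **19**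
(1971) 282–301 [Samuel1971], proof of Prop. 6 (p. 286), VERBATIM: «By induction we are reduced to the case of a product of two
factors, `A = A₁ × A₂`. Let `Aᵢ` be Euclidean for `φᵢ : Aᵢ → Wᵢ` (`i = 1, 2`). Let `W′ = W₁ × W₂` lexicographically ordered …
Call `W` the “ordinal sum” of two copies of `W′` …».

## What is formalised

* §1 **Theorem 22 for `n` factors** `A₀, …, A_n` (`A : Fin (n + 1) → Type u`, commutative rings): (a)
  `Pi.forall_exists_mem_samuelSet_iff` (any finite index type: `∏ Aᵢ` is exhausted by its construction iff every `Aᵢ` is);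
  (b) **`Pi.iSup_samuelRank_le_foldr_nadd`** (`e(∏ Aᵢ) ≤ e(A₀) ⊕ (e(A₁) ⊕ (… ⊕ e(A_n)))`, the right-hand side the iterated
  natural sum `List.foldr nadd 0` over `List.ofFn`), **`Pi.foldr_add_le_iSup_samuelRank`** (`e(A₀) + e(A₁) + … + e(A_n) ≤
  e(∏ Aᵢ)`, non-zero factors), both by Clark's induction along `∏_{i ≤ n} Aᵢ ≅ A₀ × ∏_{i < n} A_{i+1}` from the case `n = 2`
  (`Prod.add_le_iSup_samuelRank_le_nadd`); `Pi.foldr_add_le_iSup_samuelRank_le_foldr_nadd` (both bounds);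
  `Pi.iSup_samuelRank_le_foldr_nadd_of_equiv`, `Pi.foldr_add_le_iSup_samuelRank_of_equiv` (an arbitrary finite index type
  enumerated by `σ : Fin (n + 1) ≃ ι`).
* §2 **Remark 2.7, Samuel's bound `e(R × S) ≤ e(R)·e(S) + e(S)·e(R)`** (**`Prod.iSup_samuelRank_le_mul_add_mul`**, from
  Nagata's bound and Prop. 4 (b), `e(·) ≥ 1`), the chain `e(R) + e(S) ≤ e(R × S) ≤ e(R) ⊕ e(S) ≤ e(R)e(S) + e(S)e(R)`
  (`Prod.add_le_iSup_samuelRank_le_nadd_le_mul_add_mul`), and «the penalty» at `ℤ × ℤ`: Nagata's bound is attained,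
  `e(ℤ × ℤ) = ω + ω = e(ℤ) ⊕ e(ℤ)` (`IntProd.iSup_samuelRank_eq_nadd`), Samuel's is not, `e(ℤ × ℤ) < e(ℤ)e(ℤ) + e(ℤ)e(ℤ) = ω²·2`
  (`IntProd.iSup_samuelRank_lt_mul_add_mul`).
-- TODO(general form): Samuel's own target `W = (W₁ ×ₗₑₓ W₂) ⊔ (W₁ ×ₗₑₓ W₂)` (order type `(e(R₂)·e(R₁))·2` for the bottom
-- functions) is not typed; only the bound Clark attributes to that proof is.

## Mathlib / tree search

Mathlib: `Fin.consEquiv` (made a ring isomorphism `∏_{i ≤ n} Aᵢ ≅ A₀ × ∏_{i < n} A_{i+1}` inline), `RingEquiv.prodZeroRing`,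
`RingEquiv.piCongrLeft`, `Pi.evalRingHom`, `Function.surjective_eval`, `List.ofFn_succ`, `List.foldr_cons`,
`Ordinal.mul_lt_mul_of_pos_left`.  Tree: `Prod.iSup_samuelRank_le_nadd`, `Prod.add_le_iSup_samuelRank_le_nadd`
(`EuclideanOrderTypeProductUpperBound.lean`), `iSup_samuelRank_add_iSup_samuelRank_le_prod` (`EuclideanOrderTypeProduct.lean`),
`iSup_samuelRank_eq_of_ringEquiv` (`EuclideanOrderTypeEqLength.lean`, whose `Pi.iSup_samuelRank_eq_natCast_sum` and
`EuclideanOrderTypeSmallRings.lean`'s `Pi.iSup_samuelRank_eq_omega0_mul_card` are the special cases `e(Aᵢ) < ω`, `e(Aᵢ) = ω`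
of §1), `Prod.forall_exists_mem_samuelSet`, `Pi.forall_exists_mem_samuelSet` (`ProductOfEuclideanRings.lean`),
`forall_exists_mem_samuelSet_of_surjective`, `IntProd.iSup_samuelRank_eq` (`IntProdIntSmallestAlgorithm.lean`),
`iSup_samuelRank_ne_zero`, `Int.iSup_samuelRank_eq_omega0` (`EuclideanOrderTypeIndecomposable.lean`), `nadd_le_mul_add_mul`
(`NaturalSumUpperBound.lean`), `nadd_omega0_omega0` (`NaturalSumOmegaMultiples.lean`), `nadd_le_nadd_left`, `nadd_zero`
(`NaturalSum.lean`).  `rg "foldr nadd|ofFn" Literature/Algebra/EuclideanDomain` → nothing before this file.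
-/

namespace Literature.Algebra.EuclideanDomain

open Ordinal Literature.Order.Ordinal

universe u

/-! ## §1 Theorem 22 for `n` factors -/

section PiFin

/-- **Theorem 22 (a) for finitely many factors «The ring `∏ᵢ₌₁ⁿ Rᵢ` is Euclidean iff `Rᵢ` is Euclidean for all `i`»**, in the
transfinite-construction form: `∏ Aᵢ` is exhausted by its construction iff every factor is (`⇐` is Nagata's lemma for `n`
factors, `Pi.forall_exists_mem_samuelSet`; `⇒`: each `Aᵢ` is a homomorphic image). [cite: Clark2015EuclideanOrderTypes, Thm. 22 (a)] -/
theorem Pi.forall_exists_mem_samuelSet_iff {ι : Type u} [Finite ι] {A : ι → Type u} [∀ i, CommRing (A i)] :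
    (∀ z : (Π i, A i), ∃ α : Ordinal.{u}, z ∈ samuelSet (Π i, A i) α) ↔
      ∀ i, ∀ x : A i, ∃ α : Ordinal.{u}, x ∈ samuelSet (A i) α :=
  ⟨fun h i ↦ forall_exists_mem_samuelSet_of_surjective (Pi.evalRingHom A i) (Function.surjective_eval i) h,
    fun h ↦ Pi.forall_exists_mem_samuelSet (A := A) h⟩

/-- Splitting off the first factor: `∏_{i ≤ n} Aᵢ ≅ A₀ × ∏_{i < n} A_{i+1}` (`Fin.consEquiv` is a ring isomorphism; the
step «Induction reduces us to the case `n = 2`»). [cite: Clark2015EuclideanOrderTypes, proof of Thm. 22] -/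
private theorem nonempty_ringEquiv_piFin_succ {n : ℕ} (A : Fin (n + 1) → Type u) [∀ i, CommRing (A i)] :
    Nonempty ((Π i, A i) ≃+* A 0 × (Π i : Fin n, A i.succ)) :=
  ⟨{ (Fin.consEquiv A).symm with map_mul' := fun _ _ ↦ rfl, map_add' := fun _ _ ↦ rfl }⟩

/-- Theorem 22 (b), upper bound `e(∏ Aᵢ) ≤ ⊕ᵢ e(Aᵢ)`, by induction on the number of factors (explicit-argument form for the
recursion; see `Pi.iSup_samuelRank_le_foldr_nadd`). [cite: Clark2015EuclideanOrderTypes, Thm. 22 (b), (7), upper bound] -/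
private theorem Pi.iSup_samuelRank_le_foldr_nadd_aux :
    ∀ (n : ℕ) (A : Fin (n + 1) → Type u) [∀ i, CommRing (A i)],
      (∀ i, ∀ x : A i, ∃ α : Ordinal.{u}, x ∈ samuelSet (A i) α) →
        (⨆ z : (Π i, A i), (samuelRank z - 1 + 1)) ≤
          (List.ofFn fun i ↦ ⨆ x : A i, (samuelRank x - 1 + 1)).foldr nadd 0
  | 0, A, _, h => by
      -- one factor: `∏_{i < 1} Aᵢ ≅ A₀ × 0 ≅ A₀`
      obtain ⟨ε⟩ := nonempty_ringEquiv_piFin_succ A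
      have hex : ∀ z : (Π i, A i), ∃ β : Ordinal.{u}, z ∈ samuelSet (Π i, A i) β :=
        Pi.forall_exists_mem_samuelSet (A := A) h
      rw [List.ofFn_succ, List.ofFn_zero, List.foldr_cons, List.foldr_nil, nadd_zero,
        ← iSup_samuelRank_eq_of_ringEquiv
          (ε.trans (RingEquiv.prodZeroRing (A 0) (Π i : Fin 0, A i.succ)).symm) hex]
  | n + 1, A, _, h => by
      -- `e(∏_{i ≤ n+1} Aᵢ) = e(A₀ × ∏_{i ≤ n} A_{i+1}) ≤ e(A₀) ⊕ e(∏_{i ≤ n} A_{i+1}) ≤ e(A₀) ⊕ (⊕ᵢ e(A_{i+1}))`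
      obtain ⟨ε⟩ := nonempty_ringEquiv_piFin_succ A
      have hB : ∀ i : Fin (n + 1), ∀ x : A i.succ, ∃ α : Ordinal.{u}, x ∈ samuelSet (A i.succ) α := fun i ↦ h i.succ
      have IH := Pi.iSup_samuelRank_le_foldr_nadd_aux n (fun i : Fin (n + 1) ↦ A i.succ) hB
      have hexB : ∀ z : (Π i : Fin (n + 1), A i.succ), ∃ β : Ordinal.{u},
          z ∈ samuelSet (Π i : Fin (n + 1), A i.succ) β :=
        Pi.forall_exists_mem_samuelSet (A := fun i : Fin (n + 1) ↦ A i.succ) hB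
      rw [List.ofFn_succ, List.foldr_cons,
        iSup_samuelRank_eq_of_ringEquiv ε.symm (Prod.forall_exists_mem_samuelSet (h 0) hexB)]
      exact (Prod.iSup_samuelRank_le_nadd (h 0) hexB).trans (nadd_le_nadd_left IH _)

/-- Theorem 22 (b), lower bound `Σᵢ e(Aᵢ) ≤ e(∏ Aᵢ)`, by the same induction (explicit-argument form for the recursion; see
`Pi.foldr_add_le_iSup_samuelRank`). [cite: Clark2015EuclideanOrderTypes, Thm. 22 (b), (7), lower bound] -/
private theorem Pi.foldr_add_le_iSup_samuelRank_aux :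
    ∀ (n : ℕ) (A : Fin (n + 1) → Type u) [∀ i, CommRing (A i)] [∀ i, Nontrivial (A i)],
      (∀ i, ∀ x : A i, ∃ α : Ordinal.{u}, x ∈ samuelSet (A i) α) →
        (List.ofFn fun i ↦ ⨆ x : A i, (samuelRank x - 1 + 1)).foldr (· + ·) 0 ≤
          ⨆ z : (Π i, A i), (samuelRank z - 1 + 1)
  | 0, A, _, _, h => by
      obtain ⟨ε⟩ := nonempty_ringEquiv_piFin_succ A
      have hex : ∀ z : (Π i, A i), ∃ β : Ordinal.{u}, z ∈ samuelSet (Π i, A i) β :=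
        Pi.forall_exists_mem_samuelSet (A := A) h
      rw [List.ofFn_succ, List.ofFn_zero, List.foldr_cons, List.foldr_nil, add_zero,
        ← iSup_samuelRank_eq_of_ringEquiv
          (ε.trans (RingEquiv.prodZeroRing (A 0) (Π i : Fin 0, A i.succ)).symm) hex]
  | n + 1, A, _, _, h => by
      -- `e(A₀) + (e(A₁) + …) ≤ e(A₀) + e(∏_{i ≤ n} A_{i+1}) ≤ e(A₀ × ∏_{i ≤ n} A_{i+1}) = e(∏_{i ≤ n+1} Aᵢ)`
      obtain ⟨ε⟩ := nonempty_ringEquiv_piFin_succ A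
      have hB : ∀ i : Fin (n + 1), ∀ x : A i.succ, ∃ α : Ordinal.{u}, x ∈ samuelSet (A i.succ) α := fun i ↦ h i.succ
      have IH := Pi.foldr_add_le_iSup_samuelRank_aux n (fun i : Fin (n + 1) ↦ A i.succ) hB
      have hexB : ∀ z : (Π i : Fin (n + 1), A i.succ), ∃ β : Ordinal.{u},
          z ∈ samuelSet (Π i : Fin (n + 1), A i.succ) β :=
        Pi.forall_exists_mem_samuelSet (A := fun i : Fin (n + 1) ↦ A i.succ) hB
      rw [List.ofFn_succ, List.foldr_cons,
        iSup_samuelRank_eq_of_ringEquiv ε.symm (Prod.forall_exists_mem_samuelSet (h 0) hexB)]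
      exact (add_le_add le_rfl IH).trans (iSup_samuelRank_add_iSup_samuelRank_le_prod (h 0) hexB)

/-- **Theorem 22 (b), upper bound for `n + 1` factors: `e(∏ᵢ Aᵢ) ≤ e(A₀) ⊕ e(A₁) ⊕ … ⊕ e(A_n)`** (commutative rings
exhausted by their transfinite constructions; the iterated natural sum as `List.foldr nadd 0`) — «Induction reduces us to the
case `n = 2`»: `e(A₀ × ∏_{i ≥ 1} Aᵢ) ≤ e(A₀) ⊕ e(∏_{i ≥ 1} Aᵢ)`, Nagata's bound. [cite: Clark2015EuclideanOrderTypes, Thm. 22 (b),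
(7), upper bound] -/
theorem Pi.iSup_samuelRank_le_foldr_nadd {n : ℕ} {A : Fin (n + 1) → Type u} [∀ i, CommRing (A i)]
    (h : ∀ i, ∀ x : A i, ∃ α : Ordinal.{u}, x ∈ samuelSet (A i) α) :
    (⨆ z : (Π i, A i), (samuelRank z - 1 + 1)) ≤
      (List.ofFn fun i ↦ ⨆ x : A i, (samuelRank x - 1 + 1)).foldr nadd 0 :=
  Pi.iSup_samuelRank_le_foldr_nadd_aux n A h

/-- **Theorem 22 (b), lower bound for `n + 1` non-zero factors: `e(A₀) + e(A₁) + … + e(A_n) ≤ e(∏ᵢ Aᵢ)`** (the ordinal sum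
in the order of the factors, `List.foldr (· + ·) 0`), by induction from `e(R) + e(S) ≤ e(R × S)`.
[cite: Clark2015EuclideanOrderTypes, Thm. 22 (b), (7), lower bound] -/
theorem Pi.foldr_add_le_iSup_samuelRank {n : ℕ} {A : Fin (n + 1) → Type u} [∀ i, CommRing (A i)]
    [∀ i, Nontrivial (A i)] (h : ∀ i, ∀ x : A i, ∃ α : Ordinal.{u}, x ∈ samuelSet (A i) α) :
    (List.ofFn fun i ↦ ⨆ x : A i, (samuelRank x - 1 + 1)).foldr (· + ·) 0 ≤
      ⨆ z : (Π i, A i), (samuelRank z - 1 + 1) :=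
  Pi.foldr_add_le_iSup_samuelRank_aux n A h

/-- **Theorem 22 (b) as printed, (7): `e(R₁) + … + e(R_n) ≤ e(∏ᵢ₌₁ⁿ Rᵢ) ≤ e(R₁) ⊕ … ⊕ e(R_n)`** for `n ≥ 1` non-zero
commutative rings exhausted by their transfinite constructions (indexed by `Fin (n + 1)` here).
[cite: Clark2015EuclideanOrderTypes, Thm. 22 (b), (7)] -/
theorem Pi.foldr_add_le_iSup_samuelRank_le_foldr_nadd {n : ℕ} {A : Fin (n + 1) → Type u} [∀ i, CommRing (A i)]
    [∀ i, Nontrivial (A i)] (h : ∀ i, ∀ x : A i, ∃ α : Ordinal.{u}, x ∈ samuelSet (A i) α) :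
    (List.ofFn fun i ↦ ⨆ x : A i, (samuelRank x - 1 + 1)).foldr (· + ·) 0 ≤
        ⨆ z : (Π i, A i), (samuelRank z - 1 + 1) ∧
      (⨆ z : (Π i, A i), (samuelRank z - 1 + 1)) ≤
        (List.ofFn fun i ↦ ⨆ x : A i, (samuelRank x - 1 + 1)).foldr nadd 0 :=
  ⟨Pi.foldr_add_le_iSup_samuelRank h, Pi.iSup_samuelRank_le_foldr_nadd h⟩

/-- The upper bound for a product over an arbitrary finite index type, the factors enumerated as `R₁, …, R_n` by
`σ : Fin (n + 1) ≃ ι`: `e(∏_ι Aᵢ) ≤ e(A_{σ 0}) ⊕ … ⊕ e(A_{σ n})` (`∏_ι Aᵢ ≅ ∏_k A_{σ k}`, and `e` is an isomorphism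
invariant). [cite: Clark2015EuclideanOrderTypes, Thm. 22 (b), (7), upper bound] -/
theorem Pi.iSup_samuelRank_le_foldr_nadd_of_equiv {ι : Type u} {n : ℕ} (σ : Fin (n + 1) ≃ ι) {A : ι → Type u}
    [∀ i, CommRing (A i)] (h : ∀ i, ∀ x : A i, ∃ α : Ordinal.{u}, x ∈ samuelSet (A i) α) :
    (⨆ z : (Π i, A i), (samuelRank z - 1 + 1)) ≤
      (List.ofFn fun k ↦ ⨆ x : A (σ k), (samuelRank x - 1 + 1)).foldr nadd 0 := by
  have hex : ∀ z : (Π k, A (σ k)), ∃ β : Ordinal.{u}, z ∈ samuelSet (Π k, A (σ k)) β :=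
    Pi.forall_exists_mem_samuelSet (A := fun k ↦ A (σ k)) fun k ↦ h (σ k)
  rw [iSup_samuelRank_eq_of_ringEquiv (RingEquiv.piCongrLeft A σ) hex]
  exact Pi.iSup_samuelRank_le_foldr_nadd (A := fun k ↦ A (σ k)) fun k ↦ h (σ k)

/-- The lower bound for a product over an arbitrary finite index type enumerated by `σ : Fin (n + 1) ≃ ι`:
`e(A_{σ 0}) + … + e(A_{σ n}) ≤ e(∏_ι Aᵢ)` (every enumeration gives a valid ordinal-sum lower bound).
[cite: Clark2015EuclideanOrderTypes, Thm. 22 (b), (7), lower bound] -/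
theorem Pi.foldr_add_le_iSup_samuelRank_of_equiv {ι : Type u} {n : ℕ} (σ : Fin (n + 1) ≃ ι) {A : ι → Type u}
    [∀ i, CommRing (A i)] [∀ i, Nontrivial (A i)] (h : ∀ i, ∀ x : A i, ∃ α : Ordinal.{u}, x ∈ samuelSet (A i) α) :
    (List.ofFn fun k ↦ ⨆ x : A (σ k), (samuelRank x - 1 + 1)).foldr (· + ·) 0 ≤
      ⨆ z : (Π i, A i), (samuelRank z - 1 + 1) := by
  have hex : ∀ z : (Π k, A (σ k)), ∃ β : Ordinal.{u}, z ∈ samuelSet (Π k, A (σ k)) β :=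
    Pi.forall_exists_mem_samuelSet (A := fun k ↦ A (σ k)) fun k ↦ h (σ k)
  rw [iSup_samuelRank_eq_of_ringEquiv (RingEquiv.piCongrLeft A σ) hex]
  exact Pi.foldr_add_le_iSup_samuelRank (A := fun k ↦ A (σ k)) fun k ↦ h (σ k)

end PiFin

/-! ## §2 Remark 2.7: Samuel's bound `e(R₁ × R₂) ≤ e(R₁) e(R₂) + e(R₂) e(R₁)` and the penalty -/

section Samuel

variable {R S : Type u} [CommRing R] [CommRing S]

/-- **Samuel's bound «`e(R₁ × R₂) ≤ e(R₁) × e(R₂) + e(R₂) × e(R₁)`»** for commutative rings exhausted by their transfinite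
constructions — here from Nagata's bound `e(R × S) ≤ e(R) ⊕ e(S)` and Prop. 4 (b) `α ⊕ β ≤ αβ + βα` (`α, β ≥ 1`: every
`e(·) ≥ 1`), which is how Clark compares the two. [cite: Clark2015EuclideanOrderTypes, Remark 2.7 and Prop. 4 (b); Samuel1971,
proof of Prop. 6 (p. 286)] -/
theorem Prod.iSup_samuelRank_le_mul_add_mul (hR : ∀ x : R, ∃ α : Ordinal.{u}, x ∈ samuelSet R α)
    (hS : ∀ y : S, ∃ α : Ordinal.{u}, y ∈ samuelSet S α) :
    (⨆ z : R × S, (samuelRank z - 1 + 1)) ≤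
      (⨆ x : R, (samuelRank x - 1 + 1)) * (⨆ y : S, (samuelRank y - 1 + 1)) +
        (⨆ y : S, (samuelRank y - 1 + 1)) * (⨆ x : R, (samuelRank x - 1 + 1)) :=
  (Prod.iSup_samuelRank_le_nadd hR hS).trans
    (nadd_le_mul_add_mul (pos_iff_ne_zero.2 iSup_samuelRank_ne_zero)
      (pos_iff_ne_zero.2 iSup_samuelRank_ne_zero))

/-- «Samuel's bound is not as good as Nagata's»: the chain `e(R) + e(S) ≤ e(R × S) ≤ e(R) ⊕ e(S) ≤ e(R)e(S) + e(S)e(R)` for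
non-zero commutative rings exhausted by their constructions. [cite: Clark2015EuclideanOrderTypes, Thm. 22 (b), Remark 2.7,
Prop. 4 (b)] -/
theorem Prod.add_le_iSup_samuelRank_le_nadd_le_mul_add_mul [Nontrivial R] [Nontrivial S]
    (hR : ∀ x : R, ∃ α : Ordinal.{u}, x ∈ samuelSet R α) (hS : ∀ y : S, ∃ α : Ordinal.{u}, y ∈ samuelSet S α) :
    (⨆ x : R, (samuelRank x - 1 + 1)) + (⨆ y : S, (samuelRank y - 1 + 1)) ≤
        ⨆ z : R × S, (samuelRank z - 1 + 1) ∧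
      (⨆ z : R × S, (samuelRank z - 1 + 1)) ≤
        nadd (⨆ x : R, (samuelRank x - 1 + 1)) (⨆ y : S, (samuelRank y - 1 + 1)) ∧
      nadd (⨆ x : R, (samuelRank x - 1 + 1)) (⨆ y : S, (samuelRank y - 1 + 1)) ≤
        (⨆ x : R, (samuelRank x - 1 + 1)) * (⨆ y : S, (samuelRank y - 1 + 1)) +
          (⨆ y : S, (samuelRank y - 1 + 1)) * (⨆ x : R, (samuelRank x - 1 + 1)) :=
  ⟨iSup_samuelRank_add_iSup_samuelRank_le_prod hR hS, Prod.iSup_samuelRank_le_nadd hR hS,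
    nadd_le_mul_add_mul (pos_iff_ne_zero.2 iSup_samuelRank_ne_zero)
      (pos_iff_ne_zero.2 iSup_samuelRank_ne_zero)⟩

/-- At `ℤ × ℤ` Nagata's bound is attained: `e(ℤ × ℤ) = ω + ω = ω ⊕ ω = e(ℤ) ⊕ e(ℤ)` (`e(ℤ) = ω`).
[cite: Clark2015EuclideanOrderTypes, Thm. 22 (b) and Remark 2.7; Samuel1971, §3 Remark (2) (p. 286)] -/
theorem IntProd.iSup_samuelRank_eq_nadd :
    (⨆ z : ℤ × ℤ, (samuelRank z - 1 + 1)) =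
      nadd (⨆ z : ℤ, (samuelRank z - 1 + 1)) (⨆ z : ℤ, (samuelRank z - 1 + 1)) := by
  rw [IntProd.iSup_samuelRank_eq, Int.iSup_samuelRank_eq_omega0, nadd_omega0_omega0, ← one_add_one_eq_two, mul_add,
    mul_one]

/-- **«There is a penalty to pay for employing the “usual” ordinal operations»**: at `ℤ × ℤ` Samuel's bound is strict,
`e(ℤ × ℤ) = ω + ω < ω² + ω² = e(ℤ)e(ℤ) + e(ℤ)e(ℤ)`. [cite: Clark2015EuclideanOrderTypes, Remark 2.7] -/
theorem IntProd.iSup_samuelRank_lt_mul_add_mul :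
    (⨆ z : ℤ × ℤ, (samuelRank z - 1 + 1)) <
      (⨆ z : ℤ, (samuelRank z - 1 + 1)) * (⨆ z : ℤ, (samuelRank z - 1 + 1)) +
        (⨆ z : ℤ, (samuelRank z - 1 + 1)) * (⨆ z : ℤ, (samuelRank z - 1 + 1)) := by
  rw [IntProd.iSup_samuelRank_eq, Int.iSup_samuelRank_eq_omega0]
  have h2 : (2 : Ordinal.{0}) < ω := by exact_mod_cast natCast_lt_omega0 2
  calc (ω : Ordinal.{0}) + ω = ω * 2 := by rw [← one_add_one_eq_two, mul_add, mul_one]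
    _ < ω * ω := mul_lt_mul_of_pos_left h2 omega0_pos
    _ ≤ ω * ω + ω * ω := le_self_add

end Samuel

end Literature.Algebra.EuclideanDomain
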